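import Literature.AlgebraicGeometry.Frobenioids.ModelFrobenioidBaseSectionSkeleton
import Literature.AlgebraicGeometry.Frobenioids.PadicFrobenioidStandardType
import HarnessLib

/-!
# Frobenioids II, Theorem 1.2 (i), "of … model … type": the `p`-adic Frobenioid is of pre-model type
# over an ARBITRARY base, and of model type (Def. 4.5 (i)) over a base of FSM-type
# (abc-iut cell, layer L1, node `FrdII:Thm1.2(i)`; proof-only companion)

Mochizuki, *The geometry of Frobenioids II: poly-Frobenioids*, Kyushu J. Math. **62** (2008) 401–460,
§1, Theorem 1.2 (i), second sentence, p. 9 [cite: MochizukiFrdII2008, Thm 1.2 (i) p.9]: "For arbitrary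
`Λ`, the Frobenioid `C` is of isotropic, model, … type", with the printed proof "it follows from [FrdI],
Theorem 5.2, (ii), that `C` is of isotropic and model type" ([FrdI] Def. 4.5 (i) p. 86: model type =
pre-model type AND birationally Frobenius-normalized type).

PROOF-ONLY companion of `PadicFrobenioidStandardType.lean` (seat abc-iut-L1-d10; statements
`PadicFrobenioidThm12.lean`, seat abc-iut-L1-t4; node holder abc-iut-L1-d8): there the PRE-MODEL half
`thm12_isOfPreModelType` carries the hypothesis `Skeletal D` inherited from [FrdI] Thm. 5.2's
observation as filed (`ModelFrobenioid.isOfPreModelType`).  With the skeleton-free form of that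
observation (`ModelFrobenioid.isOfPreModelType_of_isDivisorial`, `ModelFrobenioidBaseSectionSkeleton.lean`,
this seat) the hypothesis disappears:
* `thm12_isOfPreModelType'` — the `p`-adic Frobenioid `C = d.frobenioid → F_Φ` of every datum is of
  pre-model type, for ANY base `D`;
* `thm12_modelType_of_isOfFSMType` — over a base of FSM-type (where `C → F_Φ` is a Frobenioid, so that
  THE birationalization exists: `isFrobenioid_of_isOfFSMType`), `C` is of model type in the sense of
  [FrdI] Def. 4.5 (i): pre-model AND birationally Frobenius-normalized (the latter = seat abc-iut-L1-d10's
  `thm12_isOfBiratFrobeniusNormalizedType_of_isOfFSMType`), i.e. the "model" clause of Thm. 1.2 (i)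
  read in the REAL vocabulary rather than through the schema slot `Thm12Vocab.IsOfModelType`.
No definitions; no statement of the paper is strengthened; no side is taken on [IUTchIII] Cor. 3.12.
-/

noncomputable section

namespace Literature.AlgebraicGeometry.Frobenioids

open CategoryTheory Opposite

universe w v u

namespace PadicFrd

namespace Datum

variable {D : Type u} [Category.{v} D] {p : ℕ} [Fact p.Prime] (d : Datum D p)

/-- **Thm. 1.2 (i)**, "model type", PRE-MODEL half ([FrdI] Def. 2.7 (iii)) over an ARBITRARY base `D`:
the `p`-adic Frobenioid is of pre-model type — the zero section over a skeleton of `D` and its Frobenius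
endomorphisms ([FrdI] Thm. 5.2 (ii), `ModelFrobenioid.isOfPreModelType_of_isDivisorial`).
[cite: MochizukiFrdII2008, Thm 1.2 (i) p.9] -/
theorem thm12_isOfPreModelType' : PreFrobenioid.IsOfPreModelType d.structureFunctor :=
  ModelFrobenioid.isOfPreModelType_of_isDivisorial (fun A => (d.isMonoprime (op A)).isDivisorial)
    d.objectwise_isGroupLike_B

/-- **Thm. 1.2 (i)**, "`C` is of … model … type" ([FrdI] Def. 4.5 (i): pre-model AND birationally
Frobenius-normalized), over a base of FSM-type: the pre-model half is `thm12_isOfPreModelType'`, the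
birationally Frobenius-normalized half (at THE birationalization of the Frobenioid `C → F_Φ`, square
completion `hsq`, e.g. `d.hasBiratSquares _`) is seat abc-iut-L1-d10's
`thm12_isOfBiratFrobeniusNormalizedType_of_isOfFSMType`. [cite: MochizukiFrdII2008, Thm 1.2 (i) p.9] -/
theorem thm12_modelType_of_isOfFSMType (hD : IsOfFSMType D)
    (hsq : PreFrobenioid.HasBiratSquares d.structureFunctor) :
    PreFrobenioid.IsOfPreModelType d.structureFunctor ∧
      PreFrobenioidData.IsOfBiratFrobeniusNormalizedType
        (PreFrobenioid.biratData (d.isFrobenioid_of_isOfFSMType hD) hsq) :=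
  ⟨d.thm12_isOfPreModelType', d.thm12_isOfBiratFrobeniusNormalizedType_of_isOfFSMType hD hsq⟩

/-- The same with the square-completion property supplied (`d.hasBiratSquares`): over a base of FSM-type
the `p`-adic Frobenioid is of model type for THE birationalization. [cite: MochizukiFrdII2008, Thm 1.2 (i) p.9] -/
theorem thm12_modelType_of_isOfFSMType' (hD : IsOfFSMType D) :
    PreFrobenioid.IsOfPreModelType d.structureFunctor ∧
      PreFrobenioidData.IsOfBiratFrobeniusNormalizedType
        (PreFrobenioid.biratData (d.isFrobenioid_of_isOfFSMType hD)
          (d.hasBiratSquares (d.isFrobenioid_of_isOfFSMType hD))) :=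
  d.thm12_modelType_of_isOfFSMType hD _

end Datum

end PadicFrd

end Literature.AlgebraicGeometry.Frobenioids

end
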